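import Summits.QuantumFields.YangMills.Theorems.UnitScaleTiltProp7B8Prop7DivAlg
import Summits.QuantumFields.YangMills.Theorems.UnitScaleTiltProp7PV3CDELogChart
import HarnessLib

/-!
# Route `UnitScaleTilt`, crux K1 child «MinimiserStabilityRegPr» (stmt-QuantumFields-19200), registered stub `stub_prop7From14` (skeleton birth_v7
# cc37a178…; leaf V3) — v8 row (D), divergence clause, THE PER-TERM ESTIMATE of [Balaban1985RegularSpaces] (1.2) at the T³ carrier: for `U₁ = e^{iX}` in (19) at
# `ε₂ ≤ ¼` over `U₀` with plaquettes within `a·η²` (`a ≤ ε₂`), `‖D*_{U₁U₀,ν}∂(U₁U₀)_{αβ} − D*_{U₀,ν}∂U₀_{αβ} − i·D*_{U₀,ν}(D_{U₀}X)_{αβ}‖ ≤ 117·ε₂²·η³`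

Cell `ym3-torus`, width seat `ym-ust-19200-w2` (gen 0; OWNER RULING g24-№1 A2′).  YM₃ on T³ is a ladder rung (R3), not the Clay problem; nothing here is a
claim about the crux, d = 4 or the mass gap.

THE PROOF.  For `U = U₁U₀`, `x′ = x − e_ν`, `w = U₀(x′,ν)`, `A = U₁(x′,ν)`, `Π, Π′` the `U₀`-plaquettes at `x, x′`, `P = ΦΠ`, `P′ = Φ′Π′` the `U`-plaquettes
(`Prop7B8Prop7DivAlg.holT_plaqWord_emb15`), `C, C′` the covariant curls of the exponent:
`D*_{U}P − D*_{U₀}Π − i·D*_{U₀}C = w^*[A^*P′A − P′]w + {w^*(Φ′ − 1 − iC′)w − (Φ − 1 − iC)} + {w^*(Φ′−1)(Π′−1)w − (Φ−1)(Π−1)}` (`decompT`); the first and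
third terms are `≤ 2|P′−1||A−1|` resp. `|Φ′−1||Π′−1| + |Φ−1||Π−1|` = `O(ε₂²η³)`; in the middle one `Φ − 1 − iC = (Φ − Φ♭) + f(Z₁,…,Z₄)` with `Φ − Φ♭ = O(|Π−1||W−1|)`
and `w^*f(Z′)w − f(Z) = f(Ad(w^*)Z′) − f(Z)` bounded by the Lipschitz constant `11ε₂η` of `f` (`Prop7ExpLipschitz.norm_plaq4_sub_plaq4_le`) times the transports
`Σ|Ad(w^*)Z′ⱼ − Zⱼ| ≤ 5ε₂η²` (`Prop7B8Prop7DivAlg.norm_transport_*`).  [Balaban1985RegularSpaces] (1.47) p. 84, Prop. 7 p. 98.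

WHAT IS PROVED (sorry-free, no definition): `decompT`, `splitT3` (ring identities), `norm_star_conj_sub_self_le`, `norm_T24_le`, `dist1_mul_inv_le`, `dist1_G_le`,
`norm_phi_sub_phiFlat_le`, `dist1_U₁_lt`, and **`norm_covDerivT_term_sub_le`** (the display above, absolute constant `117`, k-uniform).

HONEST SCOPE.  An estimate at the T³ carrier; the divergence clause itself (sum over `ν`) and the row-(D) theorem are the next file `Prop7B8Prop7Div`.  Count-neutral helper
toward stmt-QuantumFields-19200 (`--supports`), not a proof of the stub.

References: T. Bałaban, CMP 99 (1985) 75–102 [Balaban1985RegularSpaces] ((1.1)–(1.2) p.76, (1.47) p.84, Prop. 7 p.98); CMP 102 (1985) 277–309 [Balaban1985Variational]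
((2) p.278, (19) p.281, p.299); CMP 99 (1985) 389–434 [Balaban1985BackgroundPropagators] ((3.1)–(3.4) pp.390–391).
-/

noncomputable section

namespace Summit.QuantumFields.YangMills.Theorems.Prop7B8Prop7DivTerm


open Literature.MathematicalPhysics.QuantumFieldTheory.Balaban1983to89
open Literature.MathematicalPhysics.QuantumFieldTheory.Balaban1983to89.T3ContinuumYM3Torus
open Literature.MathematicalPhysics.QuantumFieldTheory.Balaban1983to89.T3UnitLawDensityEML (ℰp)
open Literature.MathematicalPhysics.QuantumFieldTheory.Balaban1983to89.T3DescentFibreTower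
open Literature.MathematicalPhysics.QuantumFieldTheory.Balaban1983to89.T3ConstrainedMinimiser
open Literature.MathematicalPhysics.QuantumFieldTheory.Balaban1983to89.T3TiltDescent
open Literature.MathematicalPhysics.QuantumFieldTheory.Balaban1983to89.T3RegularMinimiser (regThreshold)
open Literature.MathematicalPhysics.QuantumFieldTheory.Balaban1983to89.T3PrintedRegularMinimiser
open Literature.MathematicalPhysics.QuantumFieldTheory.Balaban1983to89.T3PrintedMinimiserExistence (regPr_mono plaqSmall_of_le regThreshold_mono divSmall_mono)
open B10Eq27TorusAxialLog (toUField unitsField unitsField_mem_unitaryUnits val_unitsField holT holT_plaqWord holT_plaqWord_eq_plaqHol)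
open B10Eq68TorusRegularity (plaqFT covDerivT covDivT)
open B7Prop1Explicit (plaqWord)
open B11 (Prop2Printed)
open T3Thm1Carrier
open T3Thm1CarrierNative (IsCritR2 Prop7From14At)
open T3SectALandauChart
open Summit.QuantumFields.YangMills.Theorems.Prop7CovariantCoercivity (norm_conj_sub_self_le')
open Summit.QuantumFields.YangMills.Theorems.Prop7B8Prop7Plaq (eta_le_one plaqSmall_emb15_of_in19 norm_exp_I_smul_sub_one_le')
open Summit.QuantumFields.YangMills.Theorems.Prop7ExpLipschitz (norm_plaq4_sub_plaq4_le)
open Summit.QuantumFields.YangMills.Theorems.Prop7B8Prop7DivAlg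
open Summit.QuantumFields.YangMills.Theorems.Prop7TPrint
open Summit.QuantumFields.YangMills.Theorems.Prop7PV3CDELogChart (pos_of_in19)
open NormedSpace

open scoped Matrix.Norms.L2Operator

/-! ## §1 The per-term decomposition and its small pieces -/

section Pieces

/-- THE DECOMPOSITION OF ONE TERM OF (1.2) (ring identity): with `P = φpb`, `P′ = φ′pb′`,
`[w^*A^*P′(Aw) − φpb] − [w^*pb′w − pb] − [w^*c′w − c] = w^*(A^*P′A − P′)w + (w^*(φ′ − 1 − c′)w − (φ − 1 − c)) + (w^*(φ′−1)(pb′−1)w − (φ−1)(pb−1))`. [folklore] -/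
theorem decompT {R : Type*} [Ring R] (ws w as a φ pb φ' pbp c c' : R) :
    (ws * as * (φ' * pbp) * (a * w) - φ * pb) - (ws * pbp * w - pb) - (ws * c' * w - c)
      = ws * (as * (φ' * pbp) * a - φ' * pbp) * w + (ws * (φ' - 1 - c') * w - (φ - 1 - c))
        + (ws * ((φ' - 1) * (pbp - 1)) * w - (φ - 1) * (pb - 1)) := by
  noncomm_ring

/-- Splitting the middle term along `φ = (φ − φ♭) + φ♭` (ring identity). [folklore] -/
theorem splitT3 {R : Type*} [Ring R] (ws w φ φ' ψ ψ' c c' : R) :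
    ws * (φ' - 1 - c') * w - (φ - 1 - c) = (ws * (φ' - ψ') * w - (φ - ψ)) + (ws * (ψ' - 1 - c') * w - (ψ - 1 - c)) := by
  noncomm_ring

/-- `dist1` of the cell's `SU(2)` is the operator-norm distance to `1` (unfolding; cf. `SU2Mean.dist1_eq_norm`). [cite: Balaban1985Averaging, (19) p.21] -/
private theorem dist1_eq (g : Matrix.specialUnitaryGroup (Fin 2) ℂ) : dist1 g = ‖(g : Matrix (Fin 2) (Fin 2) ℂ) - 1‖ := rfl

/-- `↑(g⁻¹) = (↑g)^*` (unfolding). [folklore] -/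
private theorem coe_inv (g : Matrix.specialUnitaryGroup (Fin 2) ℂ) :
    ((g⁻¹ : Matrix.specialUnitaryGroup (Fin 2) ℂ) : Matrix (Fin 2) (Fin 2) ℂ) = star (g : Matrix (Fin 2) (Fin 2) ℂ) := rfl

/-- `‖A^*ZA − Z‖ ≤ 2‖Z − 1‖‖A − 1‖` for `A ∈ SU(2)` (`A^*ZA − Z = A^*[(Z−1)(A−1) − (A−1)(Z−1)]`). [folklore] -/
theorem norm_star_conj_sub_self_le (A : Matrix.specialUnitaryGroup (Fin 2) ℂ) (Z : Matrix (Fin 2) (Fin 2) ℂ) :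
    ‖star (A : Matrix (Fin 2) (Fin 2) ℂ) * Z * (A : Matrix (Fin 2) (Fin 2) ℂ) - Z‖ ≤ 2 * ‖Z - 1‖ * ‖(A : Matrix (Fin 2) (Fin 2) ℂ) - 1‖ := by
  have hA : (A : Matrix (Fin 2) (Fin 2) ℂ) ∈ unitary (Matrix (Fin 2) (Fin 2) ℂ) := A.2.1
  have haa : star (A : Matrix (Fin 2) (Fin 2) ℂ) * (A : Matrix (Fin 2) (Fin 2) ℂ) = 1 := Matrix.mem_unitaryGroup_iff'.mp A.2.1
  have e : star (A : Matrix (Fin 2) (Fin 2) ℂ) * Z * (A : Matrix (Fin 2) (Fin 2) ℂ) - Z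
      = star (A : Matrix (Fin 2) (Fin 2) ℂ) * ((Z - 1) * ((A : Matrix (Fin 2) (Fin 2) ℂ) - 1) - ((A : Matrix (Fin 2) (Fin 2) ℂ) - 1) * (Z - 1)) := by
    have : star (A : Matrix (Fin 2) (Fin 2) ℂ) * ((Z - 1) * ((A : Matrix (Fin 2) (Fin 2) ℂ) - 1) - ((A : Matrix (Fin 2) (Fin 2) ℂ) - 1) * (Z - 1))
        = star (A : Matrix (Fin 2) (Fin 2) ℂ) * Z * (A : Matrix (Fin 2) (Fin 2) ℂ) - (star (A : Matrix (Fin 2) (Fin 2) ℂ) * (A : Matrix (Fin 2) (Fin 2) ℂ)) * Z := by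
      noncomm_ring
    rw [this, haa, one_mul]
  rw [e, CStarRing.norm_mem_unitary_mul _ (Unitary.star_mem hA)]
  calc _ ≤ ‖(Z - 1) * ((A : Matrix (Fin 2) (Fin 2) ℂ) - 1)‖ + ‖((A : Matrix (Fin 2) (Fin 2) ℂ) - 1) * (Z - 1)‖ := norm_sub_le _ _
    _ ≤ ‖Z - 1‖ * ‖(A : Matrix (Fin 2) (Fin 2) ℂ) - 1‖ + ‖(A : Matrix (Fin 2) (Fin 2) ℂ) - 1‖ * ‖Z - 1‖ := add_le_add (norm_mul_le _ _) (norm_mul_le _ _)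
    _ = 2 * ‖Z - 1‖ * ‖(A : Matrix (Fin 2) (Fin 2) ℂ) - 1‖ := by ring

/-- The transported correction term: `‖w^*((φ′−1)(pb′−1))w − (φ−1)(pb−1)‖ ≤ ‖φ′−1‖‖pb′−1‖ + ‖φ−1‖‖pb−1‖` (`w ∈ SU(2)`). [folklore] -/
theorem norm_T24_le (w : Matrix.specialUnitaryGroup (Fin 2) ℂ) (φ pb φ' pbp : Matrix (Fin 2) (Fin 2) ℂ) :
    ‖star (w : Matrix (Fin 2) (Fin 2) ℂ) * ((φ' - 1) * (pbp - 1)) * (w : Matrix (Fin 2) (Fin 2) ℂ) - (φ - 1) * (pb - 1)‖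
      ≤ ‖φ' - 1‖ * ‖pbp - 1‖ + ‖φ - 1‖ * ‖pb - 1‖ := by
  calc _ ≤ ‖star (w : Matrix (Fin 2) (Fin 2) ℂ) * ((φ' - 1) * (pbp - 1)) * (w : Matrix (Fin 2) (Fin 2) ℂ)‖ + ‖(φ - 1) * (pb - 1)‖ := norm_sub_le _ _
    _ ≤ _ := by rw [norm_star_mul_mul]; exact add_le_add (norm_mul_le _ _) (norm_mul_le _ _)

/-- Unitary conjugation is isometric: `‖u G u^*‖ = ‖G‖` for `u ∈ SU(2)` (local copy, cf. `SmoothLiftInterp.norm_conj_eq`). [folklore] -/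
private theorem norm_mul_mul_star' (u : Matrix.specialUnitaryGroup (Fin 2) ℂ) (G : Matrix (Fin 2) (Fin 2) ℂ) :
    ‖(u : Matrix (Fin 2) (Fin 2) ℂ) * G * star (u : Matrix (Fin 2) (Fin 2) ℂ)‖ = ‖G‖ := by
  have hu : (u : Matrix (Fin 2) (Fin 2) ℂ) ∈ unitary (Matrix (Fin 2) (Fin 2) ℂ) := u.2.1
  rw [CStarRing.norm_mul_mem_unitary _ (Unitary.star_mem hu), CStarRing.norm_mem_unitary_mul _ hu]

/-- `|PQ⁻¹ − 1| ≤ |P − 1| + |Q − 1|` in `SU(2)`. [folklore] -/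
theorem dist1_mul_inv_le (P Q : Matrix.specialUnitaryGroup (Fin 2) ℂ) : dist1 (P * Q⁻¹) ≤ dist1 P + dist1 Q := by
  have h := GaugeGroup.dist1_mul_le P Q⁻¹
  rwa [GaugeGroup.dist1_inv] at h

/-- `|(V₄W₃V₄⁻¹)⁻¹W₄⁻¹ − 1| ≤ |W₃ − 1| + |W₄ − 1|` in `SU(2)`. [folklore] -/
theorem dist1_G_le (V₄ W₃ W₄ : Matrix.specialUnitaryGroup (Fin 2) ℂ) : dist1 ((V₄ * W₃ * V₄⁻¹)⁻¹ * W₄⁻¹) ≤ dist1 W₃ + dist1 W₄ := by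
  have h := GaugeGroup.dist1_mul_le (V₄ * W₃ * V₄⁻¹)⁻¹ W₄⁻¹
  rwa [GaugeGroup.dist1_inv, GaugeGroup.dist1_inv, GaugeGroup.dist1_conj] at h

/-- **`Φ − Φ♭` IS CURVATURE × FLUCTUATION**: `‖q·(QGQ⁻¹) − q·G‖ ≤ 2|Q − 1|·|G − 1|` (`q, Q, G ∈ SU(2)`; `QGQ⁻¹ − G = Q(G−1)Q^* − (G−1)`).
[cite: Balaban1985BackgroundPropagators, (3.1)-(3.2) p.390] -/
theorem norm_phi_sub_phiFlat_le (q Q G : Matrix.specialUnitaryGroup (Fin 2) ℂ) :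
    ‖((q * (Q * G * Q⁻¹) : Matrix.specialUnitaryGroup (Fin 2) ℂ) : Matrix (Fin 2) (Fin 2) ℂ) - ((q * G : Matrix.specialUnitaryGroup (Fin 2) ℂ) : Matrix (Fin 2) (Fin 2) ℂ)‖
      ≤ 2 * dist1 Q * dist1 G := by
  have hq : (q : Matrix (Fin 2) (Fin 2) ℂ) ∈ unitary (Matrix (Fin 2) (Fin 2) ℂ) := q.2.1
  show ‖(q : Matrix (Fin 2) (Fin 2) ℂ) * ((Q : Matrix (Fin 2) (Fin 2) ℂ) * (G : Matrix (Fin 2) (Fin 2) ℂ) * star (Q : Matrix (Fin 2) (Fin 2) ℂ))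
      - (q : Matrix (Fin 2) (Fin 2) ℂ) * (G : Matrix (Fin 2) (Fin 2) ℂ)‖ ≤ _
  rw [← mul_sub, CStarRing.norm_mem_unitary_mul _ hq]
  have e : (Q : Matrix (Fin 2) (Fin 2) ℂ) * (G : Matrix (Fin 2) (Fin 2) ℂ) * star (Q : Matrix (Fin 2) (Fin 2) ℂ) - (G : Matrix (Fin 2) (Fin 2) ℂ)
      = (Q : Matrix (Fin 2) (Fin 2) ℂ) * ((G : Matrix (Fin 2) (Fin 2) ℂ) - 1) * star (Q : Matrix (Fin 2) (Fin 2) ℂ) - ((G : Matrix (Fin 2) (Fin 2) ℂ) - 1) := by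
    have hQ : (Q : Matrix (Fin 2) (Fin 2) ℂ) * star (Q : Matrix (Fin 2) (Fin 2) ℂ) = 1 := Matrix.mem_unitaryGroup_iff.mp Q.2.1
    have : (Q : Matrix (Fin 2) (Fin 2) ℂ) * ((G : Matrix (Fin 2) (Fin 2) ℂ) - 1) * star (Q : Matrix (Fin 2) (Fin 2) ℂ)
        = (Q : Matrix (Fin 2) (Fin 2) ℂ) * (G : Matrix (Fin 2) (Fin 2) ℂ) * star (Q : Matrix (Fin 2) (Fin 2) ℂ) - (Q : Matrix (Fin 2) (Fin 2) ℂ) * star (Q : Matrix (Fin 2) (Fin 2) ℂ) := by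
      noncomm_ring
    rw [this, hQ]; abel
  rw [e]
  exact norm_conj_sub_self_le' Q _

end Pieces

/-! ## §2 The per-term estimate -/

section Term

variable (F : T3Family) (n K : ℕ)

/-- The fluctuation `U₁(b) − 1` is bounded by the exponent: `‖U₁(b) − 1‖ ≤ ‖X(b)‖ < ε₂η` under (19). [cite: Balaban1985Variational, (19) p.281; Balaban1985Averaging, (24) p.21] -/
theorem dist1_U₁_lt {ε₂ : ℝ} {U₀ U₁ : GaugeField (F.P K) 0 (Matrix.specialUnitaryGroup (Fin 2) ℂ)} {X : PBond (F.P K) 0 → Matrix (Fin 2) (Fin 2) ℂ}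
    (h19 : In19 F n K ε₂ U₀ U₁ X) (b : PBond (F.P K) 0) : dist1 (U₁ b) < ε₂ * eta F n K := by
  rw [dist1_eq, h19.2.1 b]
  exact (norm_exp_I_smul_sub_one_le' (h19.1 b).1).trans_lt (h19.2.2.1 b)

/-- **THE PER-TERM ESTIMATE**: for `U₁ = e^{iX}` in (19) at `ε₂ ≤ ¼` over `U₀` with plaquettes within `a·η²`, `0 < a ≤ ε₂`, every derivative direction `ν`, index pair
`(α, β)` and site `x`: `‖D*_{U₁U₀,ν}∂(U₁U₀)_{αβ}(x) − D*_{U₀,ν}∂U₀_{αβ}(x) − i·D*_{U₀,ν}(D_{U₀}X)_{αβ}(x)‖ ≤ 117·ε₂²·η³` (unit-spacing operators).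
[cite: Balaban1985RegularSpaces, (1.1)-(1.2) p.76, (1.47) p.84, Prop. 7 p.98] -/
theorem norm_covDerivT_term_sub_le {ε₂ a : ℝ} (hε₂ : ε₂ ≤ 1 / 4) (ha0 : 0 < a) (ha : a ≤ ε₂)
    {U₀ U₁ : GaugeField (F.P K) 0 (Matrix.specialUnitaryGroup (Fin 2) ℂ)} {X : PBond (F.P K) 0 → Matrix (Fin 2) (Fin 2) ℂ}
    (hU₀ : PlaqSmall (regThreshold F n K a) U₀) (h19 : In19 F n K ε₂ U₀ U₁ X) (ν α β : Fin (F.P K).d) (x : Site (F.P K) 0) :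
    ‖covDerivT 1 (bgUnits F K (emb15 U₀ U₁)) ν (plaqFT (bgUnits F K (emb15 U₀ U₁)) α β) x
        - covDerivT 1 (bgUnits F K U₀) ν (plaqFT (bgUnits F K U₀) α β) x
        - Complex.I • covDerivT 1 (bgUnits F K U₀) ν (covCurlT 1 (bgUnits F K U₀) X α β) x‖
      ≤ 117 * ε₂ ^ 2 * eta F n K ^ 3 := by
  -- scalars
  set η : ℝ := eta F n K with hηdef
  have hη : 0 < η := eta_pos F n K
  have hη1 : η ≤ 1 := eta_le_one F n K
  have hε₂0 : 0 < ε₂ := pos_of_in19 h19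
  have hthr : ∀ c : ℝ, regThreshold F n K c = c * η ^ 2 := fun c => by rw [hηdef, eta_pow]; rfl
  have hX := h19.1
  have hU₁ := h19.2.1
  -- sites, group elements
  set x' := x.unshift ν with hx'
  set gw := U₀ ⟨x', ν⟩ with hgw
  set gA := U₁ ⟨x', ν⟩ with hgA
  set gPb := holT U₀ x (plaqWord α β) with hgPb
  set gPbp := holT U₀ x' (plaqWord α β) with hgPbp
  set gP := holT (emb15 U₀ U₁) x (plaqWord α β) with hgP
  set gP' := holT (emb15 U₀ U₁) x' (plaqWord α β) with hgP'
  -- the fluctuation words (group): `q = W₁·V₁W₂V₁⁻¹`, `G = (V₄W₃V₄⁻¹)⁻¹W₄⁻¹`, `Φ = q·QGQ⁻¹`, `Φ♭ = q·G`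
  set gq := U₁ ⟨x, α⟩ * (U₀ ⟨x, α⟩ * U₁ ⟨x.shift α, β⟩ * (U₀ ⟨x, α⟩)⁻¹) with hgq
  set gG := (U₀ ⟨x, β⟩ * U₁ ⟨x.shift β, α⟩ * (U₀ ⟨x, β⟩)⁻¹)⁻¹ * (U₁ ⟨x, β⟩)⁻¹ with hgG
  set gq' := U₁ ⟨x', α⟩ * (U₀ ⟨x', α⟩ * U₁ ⟨x'.shift α, β⟩ * (U₀ ⟨x', α⟩)⁻¹) with hgq'
  set gG' := (U₀ ⟨x', β⟩ * U₁ ⟨x'.shift β, α⟩ * (U₀ ⟨x', β⟩)⁻¹)⁻¹ * (U₁ ⟨x', β⟩)⁻¹ with hgG'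
  set gΦ := gq * (gPb * gG * gPb⁻¹) with hgΦ
  set gΦ' := gq' * (gPbp * gG' * gPbp⁻¹) with hgΦ'
  have hPΦ : gP = gΦ * gPb := by rw [hgP, holT_plaqWord_emb15, hgΦ, hgq, hgG, hgPb]
  have hPΦ' : gP' = gΦ' * gPbp := by rw [hgP', holT_plaqWord_emb15, hgΦ', hgq', hgG', hgPbp]
  -- matrices
  set w : Matrix (Fin 2) (Fin 2) ℂ := (gw : Matrix (Fin 2) (Fin 2) ℂ) with hw
  set A : Matrix (Fin 2) (Fin 2) ℂ := (gA : Matrix (Fin 2) (Fin 2) ℂ) with hA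
  set pb : Matrix (Fin 2) (Fin 2) ℂ := (gPb : Matrix (Fin 2) (Fin 2) ℂ) with hpb
  set pbp : Matrix (Fin 2) (Fin 2) ℂ := (gPbp : Matrix (Fin 2) (Fin 2) ℂ) with hpbp
  set φ : Matrix (Fin 2) (Fin 2) ℂ := (gΦ : Matrix (Fin 2) (Fin 2) ℂ) with hφ
  set φ' : Matrix (Fin 2) (Fin 2) ℂ := (gΦ' : Matrix (Fin 2) (Fin 2) ℂ) with hφ'
  set ψ : Matrix (Fin 2) (Fin 2) ℂ := ((gq * gG : Matrix.specialUnitaryGroup (Fin 2) ℂ) : Matrix (Fin 2) (Fin 2) ℂ) with hψ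
  set ψ' : Matrix (Fin 2) (Fin 2) ℂ := ((gq' * gG' : Matrix.specialUnitaryGroup (Fin 2) ℂ) : Matrix (Fin 2) (Fin 2) ℂ) with hψ'
  set C : Matrix (Fin 2) (Fin 2) ℂ := covCurlT 1 (bgUnits F K U₀) X α β x with hC
  set C' : Matrix (Fin 2) (Fin 2) ℂ := covCurlT 1 (bgUnits F K U₀) X α β x' with hC'
  have hP : ((gP : Matrix.specialUnitaryGroup (Fin 2) ℂ) : Matrix (Fin 2) (Fin 2) ℂ) = φ * pb := by rw [hPΦ, Submonoid.coe_mul]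
  have hP' : ((gP' : Matrix.specialUnitaryGroup (Fin 2) ℂ) : Matrix (Fin 2) (Fin 2) ℂ) = φ' * pbp := by rw [hPΦ', Submonoid.coe_mul]
  -- the three letters and the decomposition
  rw [covDerivT_plaqFT_emb15_eq, covDerivT_plaqFT_bg_eq, covDerivT_bg_apply]
  simp only [← hx']
  rw [← hgw, ← hgA, ← hgPb, ← hgPbp, ← hgP, ← hgP', hP, hP', ← hC, ← hC', smul_sub, ← smul_mul_assoc, ← mul_smul_comm,
    decompT (star w) w (star A) A φ pb φ' pbp (Complex.I • C) (Complex.I • C'), splitT3 (star w) w φ φ' ψ ψ' (Complex.I • C) (Complex.I • C')]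
  -- sizes
  have nA : ‖A - 1‖ < ε₂ * η := dist1_U₁_lt F n K h19 ⟨x', ν⟩
  have hUpl : PlaqSmall (regThreshold F n K (2 * a + 11 * ε₂)) (emb15 U₀ U₁) := plaqSmall_emb15_of_in19 hε₂ hU₀ h19
  have h13 : (2 * a + 11 * ε₂) * η ^ 2 ≤ 13 * ε₂ * η ^ 2 := by nlinarith [pow_pos hη 2]
  have nP' : ‖φ' * pbp - 1‖ < 13 * ε₂ * η ^ 2 := by
    rw [← hP']
    have := norm_coe_holT_plaqWord_sub_one_lt (by rw [hthr]; positivity) hUpl x' α β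
    rw [hthr] at this
    exact this.trans_le h13
  have nP : ‖φ * pb - 1‖ < 13 * ε₂ * η ^ 2 := by
    rw [← hP]
    have := norm_coe_holT_plaqWord_sub_one_lt (by rw [hthr]; positivity) hUpl x α β
    rw [hthr] at this
    exact this.trans_le h13
  have npb : ‖pb - 1‖ < a * η ^ 2 := by
    have := norm_coe_holT_plaqWord_sub_one_lt (by rw [hthr]; positivity) hU₀ x α β
    rwa [hthr] at this
  have npbp : ‖pbp - 1‖ < a * η ^ 2 := by
    have := norm_coe_holT_plaqWord_sub_one_lt (by rw [hthr]; positivity) hU₀ x' α β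
    rwa [hthr] at this
  have haη : a * η ^ 2 ≤ ε₂ * η ^ 2 := mul_le_mul_of_nonneg_right ha (pow_pos hη 2).le
  have nφ : ‖φ - 1‖ < 14 * ε₂ * η ^ 2 := by
    have h := dist1_mul_inv_le gP gPb
    have e1 : gP * gPb⁻¹ = gΦ := by rw [hPΦ, mul_inv_cancel_right]
    rw [e1, dist1_eq, dist1_eq, dist1_eq, ← hφ, ← hpb, hP] at h
    linarith
  have nφ' : ‖φ' - 1‖ < 14 * ε₂ * η ^ 2 := by
    have h := dist1_mul_inv_le gP' gPbp
    have e1 : gP' * gPbp⁻¹ = gΦ' := by rw [hPΦ', mul_inv_cancel_right]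
    rw [e1, dist1_eq, dist1_eq, dist1_eq, ← hφ', ← hpbp, hP'] at h
    linarith
  -- T₁
  have hT1 : ‖star w * (star A * (φ' * pbp) * A - φ' * pbp) * w‖ ≤ 26 * ε₂ ^ 2 * η ^ 3 := by
    rw [norm_star_mul_mul]
    refine (norm_star_conj_sub_self_le gA _).trans ?_
    have h1 : 0 ≤ ‖φ' * pbp - 1‖ := norm_nonneg _
    have h2 : 0 ≤ ‖A - 1‖ := norm_nonneg _
    nlinarith [mul_le_mul nP'.le nA.le h2 (by positivity)]
  -- T₂₄
  have hT24 : ‖star w * ((φ' - 1) * (pbp - 1)) * w - (φ - 1) * (pb - 1)‖ ≤ 28 * ε₂ ^ 2 * η ^ 3 := by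
    refine (norm_T24_le gw φ pb φ' pbp).trans ?_
    have e1 : ‖φ' - 1‖ * ‖pbp - 1‖ ≤ (14 * ε₂ * η ^ 2) * (a * η ^ 2) := mul_le_mul nφ'.le npbp.le (norm_nonneg _) (by positivity)
    have e2 : ‖φ - 1‖ * ‖pb - 1‖ ≤ (14 * ε₂ * η ^ 2) * (a * η ^ 2) := mul_le_mul nφ.le npb.le (norm_nonneg _) (by positivity)
    have haη' : a * η ≤ ε₂ := (mul_le_of_le_one_right ha0.le hη1).trans ha
    have e3 : (14 * ε₂ * η ^ 2) * (a * η ^ 2) ≤ 14 * ε₂ ^ 2 * η ^ 3 :=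
      calc (14 * ε₂ * η ^ 2) * (a * η ^ 2) = 14 * ε₂ * η ^ 3 * (a * η) := by ring
        _ ≤ 14 * ε₂ * η ^ 3 * ε₂ := mul_le_mul_of_nonneg_left haη' (by positivity)
        _ = 14 * ε₂ ^ 2 * η ^ 3 := by ring
    linarith
  -- T₃, curvature part: `Φ − Φ♭`
  have nG : dist1 gG < 2 * (ε₂ * η) := by
    refine (dist1_G_le _ _ _).trans_lt ?_
    have := dist1_U₁_lt F n K h19 ⟨x.shift β, α⟩
    have := dist1_U₁_lt F n K h19 ⟨x, β⟩
    linarith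
  have nG' : dist1 gG' < 2 * (ε₂ * η) := by
    refine (dist1_G_le _ _ _).trans_lt ?_
    have := dist1_U₁_lt F n K h19 ⟨x'.shift β, α⟩
    have := dist1_U₁_lt F n K h19 ⟨x', β⟩
    linarith
  have h4 : 2 * (a * η ^ 2) * (2 * (ε₂ * η)) ≤ 4 * ε₂ ^ 2 * η ^ 3 := by
    have : a * (ε₂ * η ^ 3) ≤ ε₂ * (ε₂ * η ^ 3) := mul_le_mul_of_nonneg_right ha (by positivity)
    nlinarith
  have nφψ : ‖φ - ψ‖ ≤ 4 * ε₂ ^ 2 * η ^ 3 := by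
    refine (norm_phi_sub_phiFlat_le gq gPb gG).trans ?_
    rw [dist1_eq, ← hpb]
    have : 2 * ‖pb - 1‖ * dist1 gG ≤ 2 * (a * η ^ 2) * (2 * (ε₂ * η)) :=
      mul_le_mul (by linarith) nG.le (GaugeGroup.dist1_nonneg _) (by positivity)
    linarith
  have nφψ' : ‖φ' - ψ'‖ ≤ 4 * ε₂ ^ 2 * η ^ 3 := by
    refine (norm_phi_sub_phiFlat_le gq' gPbp gG').trans ?_
    rw [dist1_eq, ← hpbp]
    have : 2 * ‖pbp - 1‖ * dist1 gG' ≤ 2 * (a * η ^ 2) * (2 * (ε₂ * η)) :=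
      mul_le_mul (by linarith) nG'.le (GaugeGroup.dist1_nonneg _) (by positivity)
    linarith
  have hT3a : ‖star w * (φ' - ψ') * w - (φ - ψ)‖ ≤ 8 * ε₂ ^ 2 * η ^ 3 := by
    calc _ ≤ ‖star w * (φ' - ψ') * w‖ + ‖φ - ψ‖ := norm_sub_le _ _
      _ ≤ 4 * ε₂ ^ 2 * η ^ 3 + 4 * ε₂ ^ 2 * η ^ 3 := by rw [norm_star_mul_mul]; exact add_le_add nφψ' nφψ
      _ = _ := by ring
  -- T₃, flat part: the four-factor function and its transport
  set vα : Matrix (Fin 2) (Fin 2) ℂ := ((U₀ ⟨x, α⟩ : Matrix.specialUnitaryGroup (Fin 2) ℂ) : Matrix (Fin 2) (Fin 2) ℂ) with hvα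
  set vβ : Matrix (Fin 2) (Fin 2) ℂ := ((U₀ ⟨x, β⟩ : Matrix.specialUnitaryGroup (Fin 2) ℂ) : Matrix (Fin 2) (Fin 2) ℂ) with hvβ
  set vα' : Matrix (Fin 2) (Fin 2) ℂ := ((U₀ ⟨x', α⟩ : Matrix.specialUnitaryGroup (Fin 2) ℂ) : Matrix (Fin 2) (Fin 2) ℂ) with hvα'
  set vβ' : Matrix (Fin 2) (Fin 2) ℂ := ((U₀ ⟨x', β⟩ : Matrix.specialUnitaryGroup (Fin 2) ℂ) : Matrix (Fin 2) (Fin 2) ℂ) with hvβ'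
  set Z₁ : Matrix (Fin 2) (Fin 2) ℂ := X ⟨x, α⟩ with hZ₁
  set Z₂ : Matrix (Fin 2) (Fin 2) ℂ := vα * X ⟨x.shift α, β⟩ * star vα with hZ₂
  set Z₃ : Matrix (Fin 2) (Fin 2) ℂ := vβ * X ⟨x.shift β, α⟩ * star vβ with hZ₃
  set Z₄ : Matrix (Fin 2) (Fin 2) ℂ := X ⟨x, β⟩ with hZ₄
  set Z₁' : Matrix (Fin 2) (Fin 2) ℂ := X ⟨x', α⟩ with hZ₁'
  set Z₂' : Matrix (Fin 2) (Fin 2) ℂ := vα' * X ⟨x'.shift α, β⟩ * star vα' with hZ₂'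
  set Z₃' : Matrix (Fin 2) (Fin 2) ℂ := vβ' * X ⟨x'.shift β, α⟩ * star vβ' with hZ₃'
  set Z₄' : Matrix (Fin 2) (Fin 2) ℂ := X ⟨x', β⟩ with hZ₄'
  have hψe : ψ = exp (Complex.I • Z₁) * exp (Complex.I • Z₂) * exp (Complex.I • (-Z₃)) * exp (Complex.I • (-Z₄)) := by
    rw [hψ, hgq, hgG]; exact coe_phiFlat_eq_exp4 hX hU₁ _ _ _ _ _ _
  have hψe' : ψ' = exp (Complex.I • Z₁') * exp (Complex.I • Z₂') * exp (Complex.I • (-Z₃')) * exp (Complex.I • (-Z₄')) := by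
    rw [hψ', hgq', hgG']; exact coe_phiFlat_eq_exp4 hX hU₁ _ _ _ _ _ _
  have hCe : C = Z₁ + Z₂ - Z₃ - Z₄ := by rw [hC, covCurlT_bg_eq]
  have hCe' : C' = Z₁' + Z₂' - Z₃' - Z₄' := by rw [hC', covCurlT_bg_eq]
  -- the transport `Ad(w^*)` commutes with the four-factor function
  have hsw : star w ∈ Matrix.unitaryGroup (Fin 2) ℂ := Unitary.star_mem gw.2.1
  have hconj := conj_plaq4_eq ⟨star w, hsw⟩ Z₁' Z₂' Z₃' Z₄'
  rw [show ((⟨star w, hsw⟩ : Matrix.unitaryGroup (Fin 2) ℂ) : Matrix (Fin 2) (Fin 2) ℂ) = star w from rfl, star_star] at hconj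
  -- Hermitian-ness and sizes of the eight exponents
  have hr : ε₂ * η ≤ 1 / 4 := by nlinarith
  have herZ₁ : Z₁.IsHermitian := (hX _).1
  have herZ₄ : Z₄.IsHermitian := (hX _).1
  have herZ₂ : Z₂.IsHermitian := by rw [hZ₂, Matrix.star_eq_conjTranspose]; exact Matrix.isHermitian_mul_mul_conjTranspose _ (hX _).1
  have herZ₃ : Z₃.IsHermitian := by rw [hZ₃, Matrix.star_eq_conjTranspose]; exact Matrix.isHermitian_mul_mul_conjTranspose _ (hX _).1
  have herZ₁' : Z₁'.IsHermitian := (hX _).1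
  have herZ₄' : Z₄'.IsHermitian := (hX _).1
  have herZ₂' : Z₂'.IsHermitian := by rw [hZ₂', Matrix.star_eq_conjTranspose]; exact Matrix.isHermitian_mul_mul_conjTranspose _ (hX _).1
  have herZ₃' : Z₃'.IsHermitian := by rw [hZ₃', Matrix.star_eq_conjTranspose]; exact Matrix.isHermitian_mul_mul_conjTranspose _ (hX _).1
  have herT : ∀ {Z : Matrix (Fin 2) (Fin 2) ℂ}, Z.IsHermitian → (star w * Z * w).IsHermitian := fun hZ => by
    rw [Matrix.star_eq_conjTranspose]; exact Matrix.isHermitian_conjTranspose_mul_mul _ hZ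
  have nZ₁ : ‖Z₁‖ ≤ ε₂ * η := (h19.2.2.1 _).le
  have nZ₄ : ‖Z₄‖ ≤ ε₂ * η := (h19.2.2.1 _).le
  have nZ₂ : ‖Z₂‖ ≤ ε₂ * η := by rw [hZ₂, norm_mul_mul_star']; exact (h19.2.2.1 _).le
  have nZ₃ : ‖Z₃‖ ≤ ε₂ * η := by rw [hZ₃, norm_mul_mul_star']; exact (h19.2.2.1 _).le
  have nZ₁' : ‖star w * Z₁' * w‖ ≤ ε₂ * η := by rw [norm_star_mul_mul]; exact (h19.2.2.1 _).le
  have nZ₄' : ‖star w * Z₄' * w‖ ≤ ε₂ * η := by rw [norm_star_mul_mul]; exact (h19.2.2.1 _).le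
  have nZ₂' : ‖star w * Z₂' * w‖ ≤ ε₂ * η := by rw [norm_star_mul_mul, hZ₂', norm_mul_mul_star']; exact (h19.2.2.1 _).le
  have nZ₃' : ‖star w * Z₃' * w‖ ≤ ε₂ * η := by rw [norm_star_mul_mul, hZ₃', norm_mul_mul_star']; exact (h19.2.2.1 _).le
  -- the four transports
  have t₁ : ‖star w * Z₁' * w - Z₁‖ < ε₂ * η ^ 2 := by
    have h := norm_transport_plain U₀ X x ν α
    simp only [← hx'] at h
    rw [h]; exact h19.2.2.2.1 _ _ _
  have t₄ : ‖star w * Z₄' * w - Z₄‖ < ε₂ * η ^ 2 := by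
    have h := norm_transport_plain U₀ X x ν β
    simp only [← hx'] at h
    rw [h]; exact h19.2.2.2.1 _ _ _
  have hplaq : ∀ (y : Site (F.P K) 0) (κ μ : Fin (F.P K).d),
      ‖((holT U₀ y (plaqWord κ μ) : Matrix.specialUnitaryGroup (Fin 2) ℂ) : Matrix (Fin 2) (Fin 2) ℂ) - 1‖ < a * η ^ 2 := fun y κ μ => by
    have := norm_coe_holT_plaqWord_sub_one_lt (by rw [hthr]; positivity) hU₀ y κ μ
    rwa [hthr] at this
  have t₂ : ‖star w * Z₂' * w - Z₂‖ ≤ ε₂ * η ^ 2 + 2 * (a * η ^ 2) * (ε₂ * η) := by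
    have h := norm_transport_conj_le U₀ X x ν α β
    simp only [← hx'] at h
    refine h.trans (add_le_add (h19.2.2.2.1 _ _ _).le ?_)
    exact mul_le_mul (mul_le_mul_of_nonneg_left (hplaq _ _ _).le (by norm_num)) (h19.2.2.1 _).le (norm_nonneg _) (by positivity)
  have t₃ : ‖star w * Z₃' * w - Z₃‖ ≤ ε₂ * η ^ 2 + 2 * (a * η ^ 2) * (ε₂ * η) := by
    have h := norm_transport_conj_le U₀ X x ν β α
    simp only [← hx'] at h
    refine h.trans (add_le_add (h19.2.2.2.1 _ _ _).le ?_)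
    exact mul_le_mul (mul_le_mul_of_nonneg_left (hplaq _ _ _).le (by norm_num)) (h19.2.2.1 _).le (norm_nonneg _) (by positivity)
  have key := norm_plaq4_sub_plaq4_le hr (herT herZ₁') (herT herZ₂') (herT herZ₃') (herT herZ₄') herZ₁ herZ₂ herZ₃ herZ₄
    nZ₁' nZ₂' nZ₃' nZ₄' nZ₁ nZ₂ nZ₃ nZ₄
  have haη1 : a * η ≤ 1 / 4 := ((mul_le_of_le_one_right ha0.le hη1).trans ha).trans hε₂
  have hεη2 : 0 ≤ ε₂ * η ^ 2 := by positivity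
  have h4 : 2 * (a * η ^ 2) * (ε₂ * η) ≤ (ε₂ * η ^ 2) / 2 := by
    have e : 2 * (a * η ^ 2) * (ε₂ * η) = (2 * (a * η)) * (ε₂ * η ^ 2) := by ring
    rw [e]
    have : 2 * (a * η) ≤ 1 / 2 := by linarith
    calc (2 * (a * η)) * (ε₂ * η ^ 2) ≤ (1 / 2) * (ε₂ * η ^ 2) := mul_le_mul_of_nonneg_right this hεη2
      _ = (ε₂ * η ^ 2) / 2 := by ring
  have hsum : ‖star w * Z₁' * w - Z₁‖ + ‖star w * Z₂' * w - Z₂‖ + ‖star w * Z₃' * w - Z₃‖ + ‖star w * Z₄' * w - Z₄‖ ≤ 5 * (ε₂ * η ^ 2) := by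
    have s₁ := t₁.le
    have s₄ := t₄.le
    have s₂ : ‖star w * Z₂' * w - Z₂‖ ≤ ε₂ * η ^ 2 + (ε₂ * η ^ 2) / 2 := t₂.trans (add_le_add le_rfl h4)
    have s₃ : ‖star w * Z₃' * w - Z₃‖ ≤ ε₂ * η ^ 2 + (ε₂ * η ^ 2) / 2 := t₃.trans (add_le_add le_rfl h4)
    have := add_le_add (add_le_add (add_le_add s₁ s₂) s₃) s₄
    exact this.trans (le_of_eq (by ring))
  have hT3b : ‖star w * (ψ' - 1 - Complex.I • C') * w - (ψ - 1 - Complex.I • C)‖ ≤ 55 * ε₂ ^ 2 * η ^ 3 := by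
    have e55 : 11 * (ε₂ * η) * (5 * (ε₂ * η ^ 2)) = 55 * ε₂ ^ 2 * η ^ 3 := by ring
    have fin : 11 * (ε₂ * η) * (‖star w * Z₁' * w - Z₁‖ + ‖star w * Z₂' * w - Z₂‖ + ‖star w * Z₃' * w - Z₃‖ + ‖star w * Z₄' * w - Z₄‖)
        ≤ 55 * ε₂ ^ 2 * η ^ 3 := by
      rw [← e55]; exact mul_le_mul_of_nonneg_left hsum (by positivity)
    rw [hψe', hψe, hCe, hCe', hconj]
    exact key.trans fin
  -- total
  calc _ ≤ ‖star w * (star A * (φ' * pbp) * A - φ' * pbp) * w‖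
        + ‖(star w * (φ' - ψ') * w - (φ - ψ)) + (star w * (ψ' - 1 - Complex.I • C') * w - (ψ - 1 - Complex.I • C))‖
        + ‖star w * ((φ' - 1) * (pbp - 1)) * w - (φ - 1) * (pb - 1)‖ := (norm_add_le _ _).trans (add_le_add (norm_add_le _ _) le_rfl)
    _ ≤ 26 * ε₂ ^ 2 * η ^ 3 + (8 * ε₂ ^ 2 * η ^ 3 + 55 * ε₂ ^ 2 * η ^ 3) + 28 * ε₂ ^ 2 * η ^ 3 :=
        add_le_add (add_le_add hT1 ((norm_add_le _ _).trans (add_le_add hT3a hT3b))) hT24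
    _ = 117 * ε₂ ^ 2 * η ^ 3 := by ring

end Term

end Summit.QuantumFields.YangMills.Theorems.Prop7B8Prop7DivTerm

end
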